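import Summits.HodgeConjecture.HodgeConjecture.Theorems.ConiveauProfileProducts
import Literature.AlgebraicGeometry.HodgeTheory.DivisorCupRaisesGeometricConiveau
import Literature.AlgebraicGeometry.HodgeTheory.FivefoldChowZeroDegenerateHodgeConjecture
import Literature.AlgebraicGeometry.Motives.Uniruled
import HarnessLib

/-!
# Half × weak: `HC(Y × Z)` for a half-profile `Y` and a WEAK-profile `Z` — every surface, every threefold with `N¹H³ = H³`, every fourfold
# with `CH₀` on a point; hence RCC threefold × uniruled threefold, RCC threefold × RCC FOURFOLD (cubic fourfolds as Fano) — and the second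
# honest ceiling «weak × weak» (cell `hodge-nonav`, sector SQ3, target (xiv) «HALF × WEAK»)

PROVENANCE. Cell hodge-nonav (HUMAN RULING D-0038), planner p1 g35 target (xiv) (STATUS 2026-08-28T08:14:15Z), prover seat
`hodge-nonav-19716-p2` (g3); refinement of the seat's `Theorems/ConiveauProfileProducts` (p615788, the additive-coniveau master).
SUPPORT FILE (`--supports stmt-HodgeConjecture-19654 --as helper`).

THE POINT. The master `hodgeConjectureFor_tensor_of_coniveau_profile` asks `cY i + cZ j ≥ p` on the Künneth slots `i + j = 2(p+1)`. Against a
HALF profile `cY = ⌊·/2⌋` this holds as soon as `Z` has the WEAK profile: odd degrees half (`H^{2r+1}(Z) = Nʳ`), even degrees one short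
(`H^{2r}(Z) = N^{r−1}`) — `even ⊗ even`: `i/2 + (j/2 − 1) = p`; `odd ⊗ odd`: `(i−1)/2 + (j−1)/2 = p`. The weak profile costs nothing in even
degrees up to `H²` and is exactly what hard Lefschetz + `Hᵏ ⊆ N^{k − dim}` give for free in high degrees, so its only content sits in the
middle: `H³ = N¹H³` for threefolds; `H³ = N¹`, `H⁴ = N¹`, `H⁵ = N²` for fourfolds (the last by `H⁵ = L · H³`, `L` raising coniveau,
`lefschetzPow_mem_supportedClasses_add`); NOTHING for surfaces.

CONTENT (sorry-free over tree theorems; no definition, no named fact, no new axiom): §1 `supportedClasses_eq_top_of_weakProfile` (the profile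
function `k ↦ k odd ? ⌊k/2⌋ : ⌊k/2⌋ − 1`), **`hodgeConjectureFor_tensor_of_half_of_weak_profile`**, `…_of_weak_of_half_profile` (mirror),
`weakProfile_of_half_profile`; §2 suppliers: **`weakProfile_surface`** (EVERY smooth projective surface), **`weakProfile_threefold_of_supportedClasses_three_one_eq_top`**
(every threefold with `N¹H³ = H³`; `…_of_hasChowZeroSupportedInDimLE_two`, `…_of_isUniruled` mod Debarre), `supportedClasses_five_two_of_fourfold`
(`N¹H³ = H³ ⟹ N²H⁵ = H⁵` on a fourfold), **`weakProfile_fourfold_of_hasChowZeroSupportedInDimLE_zero`**; §3 instances with `Y` an RCC threefold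
(or any half-profile variety): **`hodgeConjectureFor_tensor_threefold_of_half_of_supportedClasses_three_one_eq_top`** (× ANY threefold with
`N¹H³ = H³` — no `H²`-condition), **`…_of_isRationallyChainConnected_of_isUniruled`** (RCC × UNIRULED, mod Debarre's rational-curve fact only),
**`hodgeConjectureFor_tensor_fourfold_of_half_of_hasChowZeroSupportedInDimLE_zero`**, **`hodgeConjectureFor_threefold_tensor_fourfold_of_isRationallyChainConnected`**
(RCC threefold × RCC FOURFOLD, all codimensions, UNCONDITIONAL), `…_of_isFano` (Fano threefold × Fano fourfold — cubic fourfolds included — mod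
Kollár–Miyaoka–Mori), and the recovery of (xii) `hodgeConjectureFor_tensor_surface_of_half_profile` (half × ANY surface).

HONEST CEILINGS. (1) `weak × weak` fails already for two surfaces (`H² ⊗ H²`: `0 + 0 < 1` — K3 × K3 is the transcendental-lattice problem);
(2) `half⁴` fails at `H^{odd} ⊗ H^{odd} ⊗ H^{odd} ⊗ H^{odd}` (the abelian ladder, see `Theorems/ConiveauProfileProducts`). Nothing here proves
HC / HC_AV in general; the named facts (Debarre, KMM) appear only as displayed binders of corollaries; rung F-H1 not moved.

## References

* [Voisin2013GHCBloch] C. Voisin, The generalized Hodge and Bloch conjectures are equivalent for general complete intersections (2013), Lemma 2.1.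
* [VoisinHodgeI2002] C. Voisin, Hodge Theory and Complex Algebraic Geometry I (2002), §6.2.3 Thm. 6.25, §11.3.3 Thm. 11.38–11.41.
* [VoisinHodgeII2003] C. Voisin, Hodge Theory and Complex Algebraic Geometry II (2003), §9.2.4 Prop. 9.20, Thm. 10.17, Cor. 10.18.
* [Voisin2025] C. Voisin, Cycle classes on algebraic varieties (2025), Cor. 2.12, §4.1 Def. 4.1, §4.3.
* [BlochSrinivas1983] S. Bloch, V. Srinivas, Remarks on correspondences and algebraic cycles (1983), Thm. 1.
* [Kollar1995] J. Kollár, Rational curves on algebraic varieties (1996), Def. IV.3.2 / 4.10.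
* [KollarMiyaokaMori1992] J. Kollár, Y. Miyaoka, S. Mori, J. Differential Geom. 36 (1992), Thm. 0.1.
* [Debarre2001] O. Debarre, Higher-dimensional algebraic geometry (2001), Remarks 4.2 (4).
-/

set_option linter.dupNamespace false

noncomputable section

open CategoryTheory AlgebraicGeometry MonoidalCategory CartesianMonoidalCategory Finset
open scoped TensorProduct
open Literature.AlgebraicTopology.SingularHomology
open Literature.AlgebraicGeometry Literature.AlgebraicGeometry.Motives Literature.AlgebraicGeometry.HodgeTheory
open Literature.Geometry.Kaehler
open Literature.Barriers.HodgeConjecture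
open Summit.HodgeConjecture.HodgeConjecture.Theorems

namespace Summit.HodgeConjecture.HodgeConjecture.Theorems.ThreefoldSquare

variable {l m n : ℕ} {X Y Z S C W : SchemeOver ℂ}

/-! ## §1 Half × weak -/

/-- The WEAK profile as one function of the degree: `⌊k/2⌋` for `k` odd, `⌊k/2⌋ − 1` for `k` even. [cite: Voisin2025, §4.1 Def. 4.1] -/
theorem supportedClasses_eq_top_of_weakProfile (hodd : ∀ r : ℕ, supportedClasses Z (2 * r + 1) r = ⊤)
    (heven : ∀ r : ℕ, supportedClasses Z (2 * r) (r - 1) = ⊤) (k : ℕ) :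
    supportedClasses Z k (if k % 2 = 1 then k / 2 else k / 2 - 1) = ⊤ := by
  by_cases hk : k % 2 = 1
  · rw [if_pos hk]
    obtain ⟨r, rfl⟩ : ∃ r, k = 2 * r + 1 := ⟨k / 2, by omega⟩
    rw [show (2 * r + 1) / 2 = r by omega]
    exact hodd r
  · rw [if_neg hk]
    obtain ⟨r, rfl⟩ : ∃ r, k = 2 * r := ⟨k / 2, by omega⟩
    rw [show 2 * r / 2 = r by omega]
    exact heven r

/-- A half profile is a weak profile. [cite: Voisin2025, §4.1 Def. 4.1] -/
theorem weakProfile_of_half_profile (hc : ∀ k, supportedClasses Z k (k / 2) = ⊤) :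
    (∀ r : ℕ, supportedClasses Z (2 * r + 1) r = ⊤) ∧ (∀ r : ℕ, supportedClasses Z (2 * r) (r - 1) = ⊤) := by
  refine ⟨fun r ↦ ?_, fun r ↦ ?_⟩
  · have h := hc (2 * r + 1)
    rwa [show (2 * r + 1) / 2 = r by omega] at h
  · have h := hc (2 * r)
    rw [show 2 * r / 2 = r by omega] at h
    exact eq_top_iff.2 fun x _ ↦ supportedClasses_mono _ _ (Nat.sub_le r 1) (by rw [h]; exact Submodule.mem_top)

/-- **HALF × WEAK: `HC(Y × Z)` in every codimension for a half-profile `Y` (`Hᵏ(Y) = N^{⌊k/2⌋}`) and a weak-profile `Z` with `HC(Z)`**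
(odd degrees half, even degrees one short): on `even ⊗ even` slots `i/2 + (j/2 − 1) = p`, on `odd ⊗ odd` slots `(i−1)/2 + (j−1)/2 = p`, so the
additive-coniveau master applies. (statement: cell hodge-nonav target (xiv)) [cite: Voisin2013GHCBloch, Lemma 2.1] [cite: VoisinHodgeI2002, §11.3.3 Thm. 11.38–11.41]
[cite: Voisin2025, Cor. 2.12 and §4.1 Def. 4.1] -/
theorem hodgeConjectureFor_tensor_of_half_of_weak_profile (hY : IsSmoothProjective m Y) (hZ : IsSmoothProjective n Z) {d : ℕ}
    (hYZ : IsSmoothProjective d (Y ⊗ Z)) (hcY : ∀ k, supportedClasses Y k (k / 2) = ⊤) (hHZ : HodgeConjectureFor n Z)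
    (hodd : ∀ r : ℕ, supportedClasses Z (2 * r + 1) r = ⊤) (heven : ∀ r : ℕ, supportedClasses Z (2 * r) (r - 1) = ⊤) :
    HodgeConjectureFor d (Y ⊗ Z) := by
  refine hodgeConjectureFor_tensor_of_coniveau_profile hY hZ hYZ (hodgeConjectureFor_of_half_profile hY hcY) hHZ (fun k ↦ k / 2)
    (fun k ↦ if k % 2 = 1 then k / 2 else k / 2 - 1) hcY (supportedClasses_eq_top_of_weakProfile hodd heven)
    fun i j p _ _ _ _ hij ↦ ?_
  by_cases hj : j % 2 = 1
  · rw [if_pos hj]; omega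
  · rw [if_neg hj]; omega

/-- **WEAK × HALF** (the mirror). [cite: Voisin2013GHCBloch, Lemma 2.1] [cite: VoisinHodgeI2002, §11.3.3 Thm. 11.38–11.41] -/
theorem hodgeConjectureFor_tensor_of_weak_of_half_profile (hZ : IsSmoothProjective n Z) (hY : IsSmoothProjective m Y) {d : ℕ}
    (hZY : IsSmoothProjective d (Z ⊗ Y)) (hHZ : HodgeConjectureFor n Z) (hodd : ∀ r : ℕ, supportedClasses Z (2 * r + 1) r = ⊤)
    (heven : ∀ r : ℕ, supportedClasses Z (2 * r) (r - 1) = ⊤) (hcY : ∀ k, supportedClasses Y k (k / 2) = ⊤) :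
    HodgeConjectureFor d (Z ⊗ Y) := by
  refine hodgeConjectureFor_tensor_of_coniveau_profile hZ hY hZY hHZ (hodgeConjectureFor_of_half_profile hY hcY)
    (fun k ↦ if k % 2 = 1 then k / 2 else k / 2 - 1) (fun k ↦ k / 2) (supportedClasses_eq_top_of_weakProfile hodd heven) hcY
    fun i j p _ _ _ _ hij ↦ ?_
  by_cases hi : i % 2 = 1
  · rw [if_pos hi]; omega
  · rw [if_neg hi]; omega

/-! ## §2 Weak-profile suppliers -/

/-- **EVERY smooth projective surface has the weak profile** (`H¹ = N⁰`, `H³ = N¹` and `H⁴ = N²` by `Hᵏ ⊆ N^{k−2}`; `H⁰`, `H²` ask coniveau `0`).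
[cite: Voisin2025, §4.3 (first paragraph)] [cite: GrothendieckTopology1969, §1] -/
theorem weakProfile_surface (hS : IsSmoothProjective 2 S) :
    (∀ r : ℕ, supportedClasses S (2 * r + 1) r = ⊤) ∧ (∀ r : ℕ, supportedClasses S (2 * r) (r - 1) = ⊤) :=
  ⟨fun r ↦ eq_top_iff.2 fun x _ ↦ supportedClasses_mono _ _ (by omega) (mem_supportedClasses_sub_dim hS x),
    fun r ↦ eq_top_iff.2 fun x _ ↦ supportedClasses_mono _ _ (by omega) (mem_supportedClasses_sub_dim hS x)⟩

/-- **A smooth projective threefold with `N¹H³(X) = H³(X)` has the weak profile** (all other degrees free: `Hᵏ ⊆ N^{k−3}`).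
[cite: Voisin2025, §4.3 (first paragraph)] [cite: GrothendieckTopology1969, §1] -/
theorem weakProfile_threefold_of_supportedClasses_three_one_eq_top (hX : IsSmoothProjective 3 X)
    (h₃ : supportedClasses X 3 1 = ⊤) :
    (∀ r : ℕ, supportedClasses X (2 * r + 1) r = ⊤) ∧ (∀ r : ℕ, supportedClasses X (2 * r) (r - 1) = ⊤) := by
  refine ⟨fun r ↦ ?_, fun r ↦ eq_top_iff.2 fun x _ ↦ supportedClasses_mono _ _ (by omega) (mem_supportedClasses_sub_dim hX x)⟩
  rcases Nat.lt_or_ge r 2 with hr | hr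
  · interval_cases r
    · exact supportedClasses_zero X _
    · exact h₃
  · exact eq_top_iff.2 fun x _ ↦ supportedClasses_mono _ _ (by omega) (mem_supportedClasses_sub_dim hX x)

/-- The weak profile of a threefold with `CH₀` on a surface (Bloch–Srinivas: `N¹H³ = H³`). [cite: BlochSrinivas1983, Thm. 1 (2)]
[cite: VoisinHodgeII2003, Thm. 10.17 and §10.2.3] -/
theorem weakProfile_threefold_of_hasChowZeroSupportedInDimLE_two (hX : IsSmoothProjective 3 X)
    (hW : HasChowZeroSupportedInDimLE X 2) :
    (∀ r : ℕ, supportedClasses X (2 * r + 1) r = ⊤) ∧ (∀ r : ℕ, supportedClasses X (2 * r) (r - 1) = ⊤) :=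
  weakProfile_threefold_of_supportedClasses_three_one_eq_top hX
    (supportedClasses_eq_top_of_hasChowZeroSupportedInDimLE_of_lt hX hW (by norm_num))

/-- The weak profile of a UNIRULED threefold, CONDITIONAL on Debarre's printed fact (a rational curve through every point ⇒ `CH₀` on a
surface). [cite: Debarre2001, Remarks 4.2 (4)] [cite: BlochSrinivas1983, Thm. 1 (2)] -/
theorem weakProfile_threefold_of_isUniruled (hDeb : Debarre2001_uniruled_rationalCurve_through_every_point)
    (hX : IsSmoothProjective 3 X) (hU : IsUniruled X) :
    (∀ r : ℕ, supportedClasses X (2 * r + 1) r = ⊤) ∧ (∀ r : ℕ, supportedClasses X (2 * r) (r - 1) = ⊤) :=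
  weakProfile_threefold_of_hasChowZeroSupportedInDimLE_two hX (hDeb.hasChowZeroSupportedInDimLE hX hU)

/-- **`L` raises coniveau on a fourfold: `N¹H³(W) = H³(W) ⟹ N²H⁵(W) = H⁵(W)`** (hard Lefschetz `L : H³ ≅ H⁵` for the hyperplane class of the
tree's `HardLefschetzNFold`, and `L(NᶜHᵏ) ⊆ N^{c+1}H^{k+2}`, `lefschetzPow_mem_supportedClasses_add`). [cite: VoisinHodgeI2002, §6.2.3 Thm. 6.25]
[cite: VoisinHodgeII2003, §9.2.4 Prop. 9.20] -/
theorem supportedClasses_five_two_of_fourfold (hW : IsSmoothProjective 4 W) (h₃ : supportedClasses W 3 1 = ⊤) :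
    supportedClasses W 5 2 = ⊤ := by
  obtain ⟨Λ⟩ := nonempty_hardLefschetzNFold_holds 4 W hW
  refine eq_top_iff.2 fun y _ ↦ ?_
  obtain ⟨x, rfl⟩ := (Λ.hasHardLefschetz 1 3 (by norm_num)).2 y
  exact lefschetzPow_mem_supportedClasses_add hW Λ.hyperplaneClass_mem
    (show x ∈ supportedClasses W 3 1 by rw [h₃]; exact Submodule.mem_top) 1

/-- **A smooth projective FOURFOLD with `CH₀` on a point has the weak profile** (`H³, H⁴ = N¹` by Bloch–Srinivas, `H⁵ = N²` by the
previous lemma, the rest free) — and `HC(W)` holds (`hodgeConjectureFor_four_of_hasChowZeroSupportedInDimLE`). [cite: BlochSrinivas1983, Thm. 1]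
[cite: VoisinHodgeII2003, Thm. 10.17, Cor. 10.18 and Prop. 10.26] -/
theorem weakProfile_fourfold_of_hasChowZeroSupportedInDimLE_zero (hW : IsSmoothProjective 4 W)
    (hpt : HasChowZeroSupportedInDimLE W 0) :
    (∀ r : ℕ, supportedClasses W (2 * r + 1) r = ⊤) ∧ (∀ r : ℕ, supportedClasses W (2 * r) (r - 1) = ⊤) := by
  have h₃ : supportedClasses W 3 1 = ⊤ := supportedClasses_eq_top_of_hasChowZeroSupportedInDimLE_of_lt hW hpt (by norm_num)
  refine ⟨fun r ↦ ?_, fun r ↦ ?_⟩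
  · rcases Nat.lt_or_ge r 3 with hr | hr
    · interval_cases r
      · exact supportedClasses_zero W _
      · exact h₃
      · exact supportedClasses_five_two_of_fourfold hW h₃
    · exact eq_top_iff.2 fun x _ ↦ supportedClasses_mono _ _ (by omega) (mem_supportedClasses_sub_dim hW x)
  · rcases Nat.lt_or_ge r 3 with hr | hr
    · interval_cases r
      · exact supportedClasses_zero W _
      · exact supportedClasses_zero W _
      · exact supportedClasses_eq_top_of_hasChowZeroSupportedInDimLE_of_lt hW hpt (by norm_num)
    · exact eq_top_iff.2 fun x _ ↦ supportedClasses_mono _ _ (by omega) (mem_supportedClasses_sub_dim hW x)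

/-! ## §3 Instances -/

/-- **Half × ANY surface** (recovers `Theorems/ThreefoldTimesSurfaceConiveau` for half-profile threefolds, and gives curve × surface,
`p_g = 0` surface × any surface, …). [cite: Voisin2013GHCBloch, Lemma 2.1] [cite: VoisinHodgeI2002, §11.3.3 Thm. 11.38–11.41] -/
theorem hodgeConjectureFor_tensor_surface_of_half_profile (hY : IsSmoothProjective m Y) (hS : IsSmoothProjective 2 S)
    (hcY : ∀ k, supportedClasses Y k (k / 2) = ⊤) : HodgeConjectureFor (m + 2) (Y ⊗ S) :=
  hodgeConjectureFor_tensor_of_half_of_weak_profile hY hS (hY.tensor_holds hS) hcY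
    (hodgeConjectureFor_of_dim_le_three_holds (by norm_num) hS) (weakProfile_surface hS).1 (weakProfile_surface hS).2

/-- **Half × a threefold with `N¹H³ = H³`** (NO condition on `H²` of the threefold): e.g. an RCC threefold times ANY uniruled threefold.
[cite: Voisin2013GHCBloch, Lemma 2.1] [cite: VoisinHodgeI2002, §11.3.3 Thm. 11.38–11.41] -/
theorem hodgeConjectureFor_tensor_threefold_of_half_of_supportedClasses_three_one_eq_top (hY : IsSmoothProjective m Y)
    (hZ : IsSmoothProjective 3 Z) (hcY : ∀ k, supportedClasses Y k (k / 2) = ⊤) (h₃ : supportedClasses Z 3 1 = ⊤) :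
    HodgeConjectureFor (m + 3) (Y ⊗ Z) :=
  hodgeConjectureFor_tensor_of_half_of_weak_profile hY hZ (hY.tensor_holds hZ) hcY
    (hodgeConjectureFor_of_dim_le_three_holds le_rfl hZ) (weakProfile_threefold_of_supportedClasses_three_one_eq_top hZ h₃).1
    (weakProfile_threefold_of_supportedClasses_three_one_eq_top hZ h₃).2

/-- **An RCC threefold times a UNIRULED threefold: `HC(Y × Z)` in every codimension**, CONDITIONAL on Debarre's rational-curve fact only
(no `H²`-condition on `Z`, no `B⋆`, no `E(S)`). [cite: Kollar1995, Def. IV.3.2 (4.10)] [cite: Debarre2001, Remarks 4.2 (4)]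
[cite: BlochSrinivas1983, Thm. 1] [cite: Voisin2013GHCBloch, Lemma 2.1] -/
theorem hodgeConjectureFor_tensor_threefolds_of_isRationallyChainConnected_of_isUniruled
    (hDeb : Debarre2001_uniruled_rationalCurve_through_every_point) (hY : IsSmoothProjective 3 Y) (hZ : IsSmoothProjective 3 Z)
    (hRY : IsRationallyChainConnected Y) (hU : IsUniruled Z) : HodgeConjectureFor 6 (Y ⊗ Z) :=
  hodgeConjectureFor_tensor_threefold_of_half_of_supportedClasses_three_one_eq_top hY hZ
    (supportedClasses_threefold_eq_top_half_of_hasChowZeroSupportedInDimLE_zero hY (hRY.hasChowZeroSupportedInDimLE_zero hY))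
    (supportedClasses_eq_top_of_hasChowZeroSupportedInDimLE_of_lt hZ (hDeb.hasChowZeroSupportedInDimLE hZ hU) (by norm_num))

/-- **Half × a fourfold with `CH₀` on a point**: `HC(Y × W)` in every codimension. [cite: Voisin2013GHCBloch, Lemma 2.1]
[cite: BlochSrinivas1983, Thm. 1] [cite: VoisinHodgeI2002, §6.2.3 Thm. 6.25 and §11.3.3 Thm. 11.38–11.41] -/
theorem hodgeConjectureFor_tensor_fourfold_of_half_of_hasChowZeroSupportedInDimLE_zero (hY : IsSmoothProjective m Y)
    (hW : IsSmoothProjective 4 W) (hcY : ∀ k, supportedClasses Y k (k / 2) = ⊤) (hpt : HasChowZeroSupportedInDimLE W 0) :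
    HodgeConjectureFor (m + 4) (Y ⊗ W) :=
  hodgeConjectureFor_tensor_of_half_of_weak_profile hY hW (hY.tensor_holds hW) hcY
    (hodgeConjectureFor_four_of_hasChowZeroSupportedInDimLE hW (d := 0) (by norm_num) hpt)
    (weakProfile_fourfold_of_hasChowZeroSupportedInDimLE_zero hW hpt).1 (weakProfile_fourfold_of_hasChowZeroSupportedInDimLE_zero hW hpt).2

/-- **An RCC threefold times an RCC FOURFOLD: `HC(Y × W)` in every codimension — UNCONDITIONAL.** [cite: Kollar1995, Def. IV.3.2 (4.10)]
[cite: BlochSrinivas1983, Thm. 1] [cite: Voisin2013GHCBloch, Lemma 2.1] -/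
theorem hodgeConjectureFor_threefold_tensor_fourfold_of_isRationallyChainConnected (hY : IsSmoothProjective 3 Y)
    (hW : IsSmoothProjective 4 W) (hRY : IsRationallyChainConnected Y) (hRW : IsRationallyChainConnected W) :
    HodgeConjectureFor (3 + 4) (Y ⊗ W) :=
  hodgeConjectureFor_tensor_fourfold_of_half_of_hasChowZeroSupportedInDimLE_zero hY hW
    (supportedClasses_threefold_eq_top_half_of_hasChowZeroSupportedInDimLE_zero hY (hRY.hasChowZeroSupportedInDimLE_zero hY))
    (hRW.hasChowZeroSupportedInDimLE_zero hW)

/-- **A Fano threefold times a Fano FOURFOLD (cubic fourfolds included), modulo Kollár–Miyaoka–Mori.** CONDITIONAL on that named fact.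
[cite: KollarMiyaokaMori1992, Thm. 0.1] [cite: BlochSrinivas1983, Thm. 1] -/
theorem hodgeConjectureFor_threefold_tensor_fourfold_of_isFano (hK : KollarMiyaokaMori1992_fano_rationallyChainConnected)
    (hFY : IsFano 3 Y) (hFW : IsFano 4 W) : HodgeConjectureFor (3 + 4) (Y ⊗ W) :=
  hodgeConjectureFor_threefold_tensor_fourfold_of_isRationallyChainConnected hFY.isSmoothProjective hFW.isSmoothProjective (hK hFY) (hK hFW)

/-- **A curve (or any half-profile variety) times an RCC fourfold.** [cite: Voisin2013GHCBloch, Lemma 2.1] [cite: BlochSrinivas1983, Thm. 1] -/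
theorem hodgeConjectureFor_curve_tensor_fourfold_of_isRationallyChainConnected (hC : IsSmoothProjective 1 C) (hW : IsSmoothProjective 4 W)
    (hRW : IsRationallyChainConnected W) : HodgeConjectureFor (1 + 4) (C ⊗ W) :=
  hodgeConjectureFor_tensor_fourfold_of_half_of_hasChowZeroSupportedInDimLE_zero hC hW (supportedClasses_curve_eq_top_half hC)
    (hRW.hasChowZeroSupportedInDimLE_zero hW)

end Summit.HodgeConjecture.HodgeConjecture.Theorems.ThreefoldSquare

end
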